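import Mathlib
import Summits.NavierStokesRegularity.NavierStokesRegularity.Theorems.EulerZoomLiouvillePowerGaugeEulerLiouvilleSelfSimilarShiftedExtension
import Summits.NavierStokesRegularity.NavierStokesRegularity.Theorems.EulerZoomLiouvillePowerGaugeEulerLiouvilleSelfSimilarBoundedLoc
import HarnessLib

/-!
# The SHIFTED classical stratum of crux E: an exactly self-similar member with bounded `C²` velocity
# profile is trivial WHATEVER ITS BLOW-UP POINT `(T, x₀)`, `T ≥ 0`
# (crux `EulerZoomLiouville.PowerGaugeEulerLiouville` = stmt-NavierStokesRegularity-19832, line `birth`, rung C1)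

Route `EulerZoomLiouville` (NavierStokesRegularity).  Skeleton v16's classical stratum
(`Loc.selfSimilar_ae_eq_zero_of_boundedC2_profile`: a member exactly self-similar ABOUT THE ORIGIN with
`V ∈ C² ∩ L^∞` is trivial) is here extended to members exactly self-similar about ANY space–time point `(T, x₀)`
with `T ≥ 0` — the family RESIDUE-MEMO-19832-g8 §1 found mis-filed inside `stub_nonSelfSimilarRest`:
`u(τ, x) = (T−τ)^{γ−1} V((T−τ)^{−γ}(x − x₀))`, `p(τ, x) = (T−τ)^{2(γ−1)} P((T−τ)^{−γ}(x − x₀))`, `τ < 0`,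
`γ = 1/(2+ρ)`.  MAIN THEOREM:

* `Shifted.selfSimilar_ae_eq_zero_of_boundedC2_profile` — crux hypotheses (distributional Euler pair on the slab +
  the `A`-gauge at the origin, `0 < ρ`) + exact self-similarity about `(T, x₀)`, `T ≥ 0`, + `V ∈ C²`, `‖V‖ ≤ M`
  ⇒ `u = 0` a.e. on `(−∞,0) × ℝ³`.

Proof.  (1) The origin-centred extension `(ũ, p̃) = (selfSimilarCollapse γ 0 V, selfSimilarCollapsePressure γ 0 P)`
is a distributional Euler pair on the whole slab (`Shifted.isDistributional_selfSimilarCollapse_of_shifted`,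
`…SelfSimilarShiftedExtension`).  (2) `P ∈ L¹_loc` from the local integrability of `p̃` on the slab
(`Shifted.locallyIntegrable_pressureProfile_of_slab`: Tonelli on `(−2,−1) × B_{2R}` and the exact slice scaling
`∫_{B_a}|p̃(τ)| = (−τ)^{5γ−2}∫_{B_{(−τ)^{−γ}a}}|P|`).  (3) The lineage's profile theorems apply to `(ũ, p̃)`:
`WeakToClassical.exists_isSelfSimilarEulerProfile_of_contDiff` (CIV (3.3) classically for some `C¹` pressure) and
`Loc.eq_const_of_bounded` (a bounded `C²` self-similar Euler profile with `0 < γ < ½` is CONSTANT).  (4) The constant is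
killed by the member's OWN `A`-gauge at large radii (`Shifted.const_profile_eq_zero_of_gaugeA`: slice
`τ = −min(1, L²/2)`, `∫_{B_L}|b|² ≤ (T+1)^{2−2γ} c L^{1−2ρ}` for every `L > 0`, and `1 − 2ρ < 3`).

WHY THIS IS A GENUINE WIDENING (not a renaming): the class gauges are centred at the PHYSICAL origin; for `T > 0` they
constrain the profile only at LARGE profile scales, so the shifted family is strictly larger than the translated
origin-centred one at the weak level, and `ũ` is NOT claimed to be a class member — only its Euler identity is used.
WHAT THIS IS NOT: not NS, not E — a classical sub-stratum `--supports` stmt-19832; the weak class, `C²` profiles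
unbounded at infinity and the genuinely non-self-similar members stay OPEN. [folklore]
-/

noncomputable section

-- flat `Theorems/<Route><Decl>…` files of one crux share the namespace of the crux (tree convention: `Summit.<S>.<S>.…`)
set_option linter.dupNamespace false

open MeasureTheory Set Filter Topology Metric Function TopologicalSpace
open scoped ENNReal NNReal

namespace Summit.NavierStokesRegularity.NavierStokesRegularity.Theorems.PowerGaugeEulerLiouville

open Literature.Analysis Literature.Analysis.FunctionSpaces Literature.Analysis.FluidPDE

namespace Shifted

/-! ### `P ∈ L¹_loc` from the slab -/

/-- **Ball integrals of `|p|` for the pressure ansatz (exact scaling, `ℝ≥0∞`).**  For `τ < 0`: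
`∫_{B_a} |p(τ,x)| dx = (−τ)^{5γ−2} ∫_{B_{(−τ)^{−γ} a}} |P|` for `p = selfSimilarCollapsePressure γ 0 P`
(factor `(−τ)^{2(γ−1)}`, Jacobian `(−τ)^{3γ}`; the `L¹` twin of `lintegral_ball_enorm_rpow_selfSimilarCollapsePressure`).
[folklore] -/
theorem lintegral_ball_enorm_selfSimilarCollapsePressure (γ : ℝ) {τ : ℝ} (hτ : τ < 0)
    (P : EuclideanSpace ℝ (Fin 3) → ℝ) (a : ℝ) :
    ∫⁻ x in ball (0 : EuclideanSpace ℝ (Fin 3)) a, ‖selfSimilarCollapsePressure γ 0 P τ x‖ₑ =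
      ENNReal.ofReal ((-τ) ^ (5 * γ - 2)) *
        ∫⁻ y in ball (0 : EuclideanSpace ℝ (Fin 3)) ((-τ) ^ (-γ) * a), ‖P y‖ₑ := by
  have hs : 0 < -τ := neg_pos.2 hτ
  have ht : 0 < (-τ) ^ (-γ) := Real.rpow_pos_of_pos hs _
  have h1 : ∀ x, ‖selfSimilarCollapsePressure γ 0 P τ x‖ₑ =
      ENNReal.ofReal ((-τ) ^ (2 * (γ - 1))) * ‖P ((-τ) ^ (-γ) • x)‖ₑ := by
    intro x
    rw [selfSimilarCollapsePressure_apply, zero_sub, enorm_mul, Real.enorm_eq_ofReal (Real.rpow_nonneg hs.le _)]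
  simp_rw [h1]
  rw [lintegral_const_mul' _ _ ENNReal.ofReal_ne_top,
    lintegral_ball_comp_smul (fun y => ‖P y‖ₑ) ht a, ← mul_assoc, ← ENNReal.ofReal_mul (Real.rpow_nonneg hs.le _)]
  congr 2
  rw [← Real.rpow_natCast ((-τ) ^ (-γ)) 3, ← Real.rpow_mul hs.le, ← Real.rpow_neg hs.le, ← Real.rpow_add hs]
  congr 1
  push_cast
  ring

/-- **`P ∈ L¹_loc` FROM THE SLAB.**  If the pressure ansatz `p̃ = selfSimilarCollapsePressure γ 0 P` (`0 ≤ γ ≤ 1`) is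
locally integrable on the open slab `(−∞,0) × ℝ³` and `P` is a.e.-strongly measurable, then `P ∈ L¹_loc(ℝ³)`: by
Tonelli on `(−2,−1) × B_{2R}` and the slice scaling, `¼ ∫_{B_R}|P| ≤ ∫∫_{(−2,−1)×B_{2R}} |p̃| < ∞`. [folklore] -/
theorem locallyIntegrable_pressureProfile_of_slab {γ : ℝ} (hγ0 : 0 ≤ γ) (hγ1 : γ ≤ 1)
    {P : EuclideanSpace ℝ (Fin 3) → ℝ} (hPm : AEStronglyMeasurable P volume)
    (hp : LocallyIntegrableOn (uncurry (selfSimilarCollapsePressure γ 0 P))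
      (((slab (EuclideanSpace ℝ (Fin 3)) (Iio 0) isOpen_Iio : Opens (ℝ × EuclideanSpace ℝ (Fin 3))) :
        Set (ℝ × EuclideanSpace ℝ (Fin 3)))) volume) :
    LocallyIntegrable P volume := by
  -- ### finiteness of `∫_{B_R} |P|` for every `R > 0`
  have hball : ∀ R : ℝ, 0 < R → ∫⁻ y in ball (0 : EuclideanSpace ℝ (Fin 3)) R, ‖P y‖ₑ < ⊤ := by
    intro R hR
    set X : ℝ≥0∞ := ∫⁻ y in ball (0 : EuclideanSpace ℝ (Fin 3)) R, ‖P y‖ₑ with hX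
    -- the compact box `[−2,−1] × closedBall 0 (2R)` inside the slab
    set K : Set (ℝ × EuclideanSpace ℝ (Fin 3)) := Icc (-2 : ℝ) (-1) ×ˢ closedBall (0 : EuclideanSpace ℝ (Fin 3)) (2 * R)
      with hK
    have hKc : IsCompact K := isCompact_Icc.prod (isCompact_closedBall _ _)
    have hKs : K ⊆ (((slab (EuclideanSpace ℝ (Fin 3)) (Iio 0) isOpen_Iio : Opens (ℝ × EuclideanSpace ℝ (Fin 3))) :
        Set (ℝ × EuclideanSpace ℝ (Fin 3)))) := by
      intro z hz
      rw [SetLike.mem_coe, mem_slab, mem_Iio]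
      have := hz.1.2
      linarith
    have hIK : IntegrableOn (uncurry (selfSimilarCollapsePressure γ 0 P)) K volume :=
      (locallyIntegrableOn_iff (slab (EuclideanSpace ℝ (Fin 3)) (Iio 0) isOpen_Iio).isOpen.isLocallyClosed).1 hp K hKs hKc
    -- the open box `S = (−2,−1) × B_{2R} ⊆ K`
    set S : Set (ℝ × EuclideanSpace ℝ (Fin 3)) := Ioo (-2 : ℝ) (-1) ×ˢ ball (0 : EuclideanSpace ℝ (Fin 3)) (2 * R)
      with hS
    have hSK : S ⊆ K := prod_mono Ioo_subset_Icc_self ball_subset_closedBall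
    have hIS : IntegrableOn (uncurry (selfSimilarCollapsePressure γ 0 P)) S volume := hIK.mono_set hSK
    have hfin : ∫⁻ z in S, ‖uncurry (selfSimilarCollapsePressure γ 0 P) z‖ₑ < ⊤ := hIS.2
    -- Tonelli on `S`
    have hmeasS : AEMeasurable (fun z : ℝ × EuclideanSpace ℝ (Fin 3) => ‖uncurry (selfSimilarCollapsePressure γ 0 P) z‖ₑ)
        (((volume : Measure ℝ).restrict (Ioo (-2 : ℝ) (-1))).prod
          ((volume : Measure (EuclideanSpace ℝ (Fin 3))).restrict (ball (0 : EuclideanSpace ℝ (Fin 3)) (2 * R)))) := by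
      rw [Measure.prod_restrict, ← Measure.volume_eq_prod]
      exact hIS.1.aemeasurable.enorm
    have hprod : ∫⁻ z in S, ‖uncurry (selfSimilarCollapsePressure γ 0 P) z‖ₑ =
        ∫⁻ t in Ioo (-2 : ℝ) (-1), ∫⁻ x in ball (0 : EuclideanSpace ℝ (Fin 3)) (2 * R),
          ‖selfSimilarCollapsePressure γ 0 P t x‖ₑ := by
      rw [hS, Measure.volume_eq_prod, ← Measure.prod_restrict, lintegral_prod _ hmeasS]
      rfl
    -- lower bound of every slice: `¼ X ≤ ∫_{B_{2R}} |p̃(t)|` for `t ∈ (−2,−1)`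
    have hslice : ∀ t ∈ Ioo (-2 : ℝ) (-1),
        ENNReal.ofReal (1 / 4) * X ≤
          ∫⁻ x in ball (0 : EuclideanSpace ℝ (Fin 3)) (2 * R), ‖selfSimilarCollapsePressure γ 0 P t x‖ₑ := by
      intro t ht
      have ht0 : t < 0 := by linarith [ht.2]
      have hs1 : 1 ≤ -t := by linarith [ht.2]
      have hs2 : -t ≤ 2 := by linarith [ht.1]
      have hs : 0 < -t := by linarith
      rw [lintegral_ball_enorm_selfSimilarCollapsePressure γ ht0 P (2 * R)]
      -- `(−t)^{5γ−2} ≥ 1/4` and `(−t)^{−γ}·2R ≥ R`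
      have hpow : 1 / 4 ≤ (-t) ^ (5 * γ - 2) := by
        rw [show 5 * γ - 2 = 5 * γ + (-2 : ℝ) by ring, Real.rpow_add hs]
        have h1 : 1 ≤ (-t) ^ (5 * γ) := Real.one_le_rpow hs1 (by linarith)
        have h2 : 1 / 4 ≤ (-t) ^ (-2 : ℝ) := by
          rw [Real.rpow_neg hs.le, show (2 : ℝ) = ((2 : ℕ) : ℝ) by norm_num, Real.rpow_natCast]
          rw [one_div, inv_le_inv₀ (by positivity) (by positivity)]
          nlinarith
        calc (1 : ℝ) / 4 = 1 * (1 / 4) := by ring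
          _ ≤ (-t) ^ (5 * γ) * (-t) ^ (-2 : ℝ) := mul_le_mul h1 h2 (by norm_num) (by linarith)
      have hrad : R ≤ (-t) ^ (-γ) * (2 * R) := by
        have h3 : 1 / 2 ≤ (-t) ^ (-γ) := by
          rw [Real.rpow_neg hs.le, one_div, inv_le_inv₀ two_pos (Real.rpow_pos_of_pos hs _)]
          calc (-t) ^ γ ≤ 2 ^ γ := Real.rpow_le_rpow hs.le hs2 hγ0
            _ ≤ 2 ^ (1 : ℝ) := Real.rpow_le_rpow_of_exponent_le (by norm_num) hγ1
            _ = 2 := Real.rpow_one 2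
        nlinarith
      calc ENNReal.ofReal (1 / 4) * X
          ≤ ENNReal.ofReal ((-t) ^ (5 * γ - 2)) * X := by gcongr
        _ ≤ ENNReal.ofReal ((-t) ^ (5 * γ - 2)) *
            ∫⁻ y in ball (0 : EuclideanSpace ℝ (Fin 3)) ((-t) ^ (-γ) * (2 * R)), ‖P y‖ₑ := by
          gcongr
          exact lintegral_mono_set (ball_subset_ball hrad)
    -- integrate the lower bound over `t ∈ (−2,−1)` (length `1`)
    have hlow : ENNReal.ofReal (1 / 4) * X ≤ ∫⁻ z in S, ‖uncurry (selfSimilarCollapsePressure γ 0 P) z‖ₑ := by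
      rw [hprod]
      calc ENNReal.ofReal (1 / 4) * X
          = ∫⁻ _ in Ioo (-2 : ℝ) (-1), ENNReal.ofReal (1 / 4) * X := by
            rw [setLIntegral_const, Real.volume_Ioo]; norm_num
        _ ≤ ∫⁻ t in Ioo (-2 : ℝ) (-1), ∫⁻ x in ball (0 : EuclideanSpace ℝ (Fin 3)) (2 * R),
              ‖selfSimilarCollapsePressure γ 0 P t x‖ₑ :=
            setLIntegral_mono' measurableSet_Ioo fun t ht => hslice t ht
    have h4 : ENNReal.ofReal (1 / 4) ≠ 0 := by
      rw [ENNReal.ofReal_ne_zero_iff]; norm_num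
    have hX4 : ENNReal.ofReal (1 / 4) * X < ⊤ := lt_of_le_of_lt hlow hfin
    rcases ENNReal.mul_lt_top_iff.1 hX4 with h | h | h
    · exact h.2
    · exact absurd h h4
    · rw [h]; exact ENNReal.zero_lt_top
  -- ### local integrability
  have hInt : ∀ R : ℝ, 0 < R → IntegrableOn P (ball (0 : EuclideanSpace ℝ (Fin 3)) R) volume :=
    fun R hR => ⟨hPm.restrict, hball R hR⟩
  intro x
  exact ⟨ball 0 (‖x‖ + 1), isOpen_ball.mem_nhds (by rw [mem_ball, dist_zero_right]; linarith),
    hInt _ (by positivity)⟩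

/-! ### The member's own `A`-gauge kills a constant profile, whatever the blow-up point -/

/-- **A CONSTANT PROFILE IS KILLED BY THE `A`-GAUGE, FOR ANY BLOW-UP POINT.**  If `u(τ, x) = (T−τ)^{γ−1} b`
(`γ = 1/(2+ρ)`, `ρ > 0`, `T ≥ 0`; the shifted ansatz of the constant profile `b`, any centre `x₀`) and the power-gauged
scaled energy at the origin obeys `a^{2ρ} A(a; 0) ≤ c` for all `a > 0`, then `b = 0`: the slice `τ = −min(1, L²/2)`
of the gauge at radius `L` gives `∫_{B_L} |b|² ≤ (T+1)^{2−2γ} c L^{1−2ρ}` for every `L > 0`, and `1 − 2ρ < 3`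
(`NoDrift.eq_zero_of_const_of_lintegral_ball_le`). [folklore] -/
theorem const_profile_eq_zero_of_gaugeA {ρ : ℝ} (hρ : 0 < ρ) {T : ℝ} (hT : 0 ≤ T) (x₀ : EuclideanSpace ℝ (Fin 3))
    {u : ℝ → EuclideanSpace ℝ (Fin 3) → EuclideanSpace ℝ (Fin 3)} {b : EuclideanSpace ℝ (Fin 3)} {c : ℝ≥0}
    (hu : ∀ τ : ℝ, τ < 0 → u τ = fun x => selfSimilarCollapse (1 / (2 + ρ)) T (fun _ => b) τ (x - x₀))
    (hA : ∀ a : ℝ, 0 < a → ENNReal.ofReal (a ^ (2 * ρ)) *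
      cknA a (0 : ℝ × EuclideanSpace ℝ (Fin 3)) u ≤ (c : ℝ≥0∞)) :
    b = 0 := by
  set γ : ℝ := 1 / (2 + ρ) with hγ
  -- the lower bound `k = (T+1)^{2(γ−1)}` of the squared time factor on the slices used
  set k : ℝ := (T + 1) ^ (2 * (γ - 1)) with hk
  have hT1 : 0 < T + 1 := by linarith
  have hk0 : 0 < k := Real.rpow_pos_of_pos hT1 _
  refine NoDrift.eq_zero_of_const_of_lintegral_ball_le (C := ENNReal.ofReal k⁻¹ * (c : ℝ≥0∞))
    (ENNReal.mul_ne_top ENNReal.ofReal_ne_top ENNReal.coe_ne_top) (θ := 1 - 2 * ρ) (by linarith) fun L hL => ?_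
  -- ### the time slice `τ = −m`, `m = min 1 (L²/2) ∈ (0, L²)`
  set m : ℝ := min 1 (L ^ 2 / 2) with hm
  have hL2 : 0 < L ^ 2 := by positivity
  have hm0 : 0 < m := lt_min one_pos (by positivity)
  have hm1 : m ≤ 1 := min_le_left _ _
  have hmL : m < L ^ 2 := lt_of_le_of_lt (min_le_right _ _) (by linarith)
  have hτ : (-m) ∈ Ioo ((0 : ℝ × EuclideanSpace ℝ (Fin 3)).1 - L ^ 2) (0 : ℝ × EuclideanSpace ℝ (Fin 3)).1 := by
    simp only [Prod.fst_zero, zero_sub, mem_Ioo]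
    exact ⟨by linarith, by linarith⟩
  have hslice : (ENNReal.ofReal L)⁻¹ * ∫⁻ x in ball (0 : EuclideanSpace ℝ (Fin 3)) L, ‖u (-m) x‖ₑ ^ 2 ≤
      cknA L (0 : ℝ × EuclideanSpace ℝ (Fin 3)) u := by
    unfold cknA
    exact le_iSup₂ (f := fun t (_ : t ∈ Ioo ((0 : ℝ × EuclideanSpace ℝ (Fin 3)).1 - L ^ 2)
        (0 : ℝ × EuclideanSpace ℝ (Fin 3)).1) =>
        (ENNReal.ofReal L)⁻¹ * ∫⁻ x in ball (0 : ℝ × EuclideanSpace ℝ (Fin 3)).2 L, ‖u t x‖ₑ ^ 2) (-m) hτ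
  have hgauge : ENNReal.ofReal (L ^ (2 * ρ)) * ((ENNReal.ofReal L)⁻¹ *
      ∫⁻ x in ball (0 : EuclideanSpace ℝ (Fin 3)) L, ‖u (-m) x‖ₑ ^ 2) ≤ (c : ℝ≥0∞) :=
    calc ENNReal.ofReal (L ^ (2 * ρ)) * ((ENNReal.ofReal L)⁻¹ *
          ∫⁻ x in ball (0 : EuclideanSpace ℝ (Fin 3)) L, ‖u (-m) x‖ₑ ^ 2)
        ≤ ENNReal.ofReal (L ^ (2 * ρ)) * cknA L (0 : ℝ × EuclideanSpace ℝ (Fin 3)) u := by gcongr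
      _ ≤ (c : ℝ≥0∞) := hA L hL
  -- ### the slice is the constant `(T+m)^{γ−1} • b`, whose square norm is `≥ k ‖b‖²`
  have hTm : 0 < T + m := by linarith
  have huval : ∀ x, u (-m) x = (T + m) ^ (γ - 1) • b := by
    intro x
    rw [hu (-m) (by linarith)]
    simp only [selfSimilarCollapse_apply, sub_neg_eq_add]
  have hfac : ENNReal.ofReal k * ‖b‖ₑ ^ 2 ≤ ‖(T + m) ^ (γ - 1) • b‖ₑ ^ 2 := by
    rw [enorm_smul, mul_pow, Real.enorm_eq_ofReal (Real.rpow_nonneg hTm.le _),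
      ← ENNReal.ofReal_pow (Real.rpow_nonneg hTm.le _), ← Real.rpow_natCast ((T + m) ^ (γ - 1)) 2,
      ← Real.rpow_mul hTm.le, show (γ - 1) * ((2 : ℕ) : ℝ) = 2 * (γ - 1) by push_cast; ring]
    gcongr
    rw [hk]
    exact Real.rpow_le_rpow_of_nonpos hTm (by linarith) (by
      have : γ < 1 := by
        rw [hγ, div_lt_one (by linarith)]; linarith
      linarith)
  have hint : ENNReal.ofReal k * ∫⁻ _ in ball (0 : EuclideanSpace ℝ (Fin 3)) L, ‖b‖ₑ ^ 2 ≤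
      ∫⁻ x in ball (0 : EuclideanSpace ℝ (Fin 3)) L, ‖u (-m) x‖ₑ ^ 2 := by
    rw [← lintegral_const_mul' _ _ ENNReal.ofReal_ne_top]
    refine lintegral_mono fun x => ?_
    rw [huval x]
    exact hfac
  -- ### combine and unscale
  set Y : ℝ≥0∞ := ∫⁻ _ in ball (0 : EuclideanSpace ℝ (Fin 3)) L, ‖b‖ₑ ^ 2 with hY
  have hKL : ENNReal.ofReal (L ^ (2 * ρ)) * (ENNReal.ofReal L)⁻¹ = ENNReal.ofReal (L ^ (2 * ρ - 1)) := by
    rw [← ENNReal.ofReal_inv_of_pos hL, ← ENNReal.ofReal_mul (by positivity), Real.rpow_sub_one hL.ne',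
      div_eq_mul_inv]
  have hfin : ENNReal.ofReal (L ^ (2 * ρ - 1)) * (ENNReal.ofReal k * Y) ≤ (c : ℝ≥0∞) :=
    calc ENNReal.ofReal (L ^ (2 * ρ - 1)) * (ENNReal.ofReal k * Y)
        = ENNReal.ofReal (L ^ (2 * ρ)) * ((ENNReal.ofReal L)⁻¹ * (ENNReal.ofReal k * Y)) := by
          rw [← hKL, mul_assoc]
      _ ≤ ENNReal.ofReal (L ^ (2 * ρ)) * ((ENNReal.ofReal L)⁻¹ *
          ∫⁻ x in ball (0 : EuclideanSpace ℝ (Fin 3)) L, ‖u (-m) x‖ₑ ^ 2) := by gcongr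
      _ ≤ (c : ℝ≥0∞) := hgauge
  have hunit : ENNReal.ofReal k⁻¹ * ENNReal.ofReal (L ^ (1 - 2 * ρ)) *
      (ENNReal.ofReal (L ^ (2 * ρ - 1)) * ENNReal.ofReal k) = 1 := by
    rw [← ENNReal.ofReal_mul (by positivity), ← ENNReal.ofReal_mul (by positivity),
      ← ENNReal.ofReal_mul (by positivity), ← ENNReal.ofReal_one]
    congr 1
    rw [show k⁻¹ * L ^ (1 - 2 * ρ) * (L ^ (2 * ρ - 1) * k) = (k⁻¹ * k) * (L ^ (1 - 2 * ρ) * L ^ (2 * ρ - 1)) by ring,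
      inv_mul_cancel₀ hk0.ne', ← Real.rpow_add hL, show (1 - 2 * ρ) + (2 * ρ - 1) = 0 by ring, Real.rpow_zero,
      one_mul]
  calc Y = ENNReal.ofReal k⁻¹ * ENNReal.ofReal (L ^ (1 - 2 * ρ)) *
        (ENNReal.ofReal (L ^ (2 * ρ - 1)) * (ENNReal.ofReal k * Y)) := by
        rw [← mul_assoc (ENNReal.ofReal (L ^ (2 * ρ - 1))), ← mul_assoc, hunit, one_mul]
    _ ≤ ENNReal.ofReal k⁻¹ * ENNReal.ofReal (L ^ (1 - 2 * ρ)) * (c : ℝ≥0∞) := by gcongr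
    _ = ENNReal.ofReal k⁻¹ * (c : ℝ≥0∞) * ENNReal.ofReal (L ^ (1 - 2 * ρ)) := by ring

/-! ### Member level: the shifted classical stratum -/

/-- **THE SHIFTED CLASSICAL STRATUM, MEMBER LEVEL.**  Let `(u, p)` be a distributional Euler pair on
`(−∞,0) × ℝ³` whose power-gauged scaled energy at the origin obeys `a^{2ρ} A(a; 0) ≤ c` for all `a > 0` (`ρ > 0`;
both are among crux E's hypotheses), exactly self-similar about the space–time point `(T, x₀)`, `T ≥ 0`, with the
class exponent `γ = 1/(2+ρ)` and profile `(V, P)`.  If `V ∈ C²` and `‖V‖ ≤ M`, then `u = 0` a.e. on `(−∞,0) × ℝ³`.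
Nothing is assumed on the pressure profile, the gradient, the far field or the stagnation set; for `(T, x₀) = (0,0)`
this is `Loc.selfSimilar_ae_eq_zero_of_boundedC2_profile` (with fewer hypotheses: only the Euler identity and the
`A`-gauge are used). [folklore] -/
theorem selfSimilar_ae_eq_zero_of_boundedC2_profile {ρ : ℝ} (hρ : 0 < ρ) {T : ℝ} (hT : 0 ≤ T)
    (x₀ : EuclideanSpace ℝ (Fin 3))
    {u : ℝ → EuclideanSpace ℝ (Fin 3) → EuclideanSpace ℝ (Fin 3)} {p : ℝ → EuclideanSpace ℝ (Fin 3) → ℝ} {c : ℝ≥0}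
    (hsol : IsDistributionalNSSolutionOn (slab (EuclideanSpace ℝ (Fin 3)) (Iio 0) isOpen_Iio) 0 0 u p)
    (hA : ∀ a : ℝ, 0 < a → ENNReal.ofReal (a ^ (2 * ρ)) *
      cknA a (0 : ℝ × EuclideanSpace ℝ (Fin 3)) u ≤ (c : ℝ≥0∞))
    {V : EuclideanSpace ℝ (Fin 3) → EuclideanSpace ℝ (Fin 3)} {P : EuclideanSpace ℝ (Fin 3) → ℝ}
    (hu : ∀ τ : ℝ, τ < 0 → u τ = fun x => selfSimilarCollapse (1 / (2 + ρ)) T V τ (x - x₀))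
    (hp : ∀ τ : ℝ, τ < 0 → p τ = fun x => selfSimilarCollapsePressure (1 / (2 + ρ)) T P τ (x - x₀))
    (hV : ContDiff ℝ 2 V) {M : ℝ} (hM : ∀ y, ‖V y‖ ≤ M) :
    uncurry u =ᵐ[volume.restrict (Iio (0 : ℝ) ×ˢ (univ : Set (EuclideanSpace ℝ (Fin 3))))] 0 := by
  have h2ρ : (0 : ℝ) < 2 + ρ := by linarith
  have hγ : (0 : ℝ) < 1 / (2 + ρ) := one_div_pos.2 h2ρ
  have hγ2 : 1 / (2 + ρ) < 1 / 2 := one_div_lt_one_div_of_lt two_pos (by linarith)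
  -- (1) the origin-centred extension is a distributional Euler pair on the whole slab
  have hext := isDistributional_selfSimilarCollapse_of_shifted hT x₀ hsol hu hp
  -- (2) `P ∈ L¹_loc`
  have hpm : AEStronglyMeasurable (uncurry (selfSimilarCollapsePressure (1 / (2 + ρ)) 0 P))
      (volume.restrict (Iio (0 : ℝ) ×ˢ (univ : Set (EuclideanSpace ℝ (Fin 3))))) := by
    have := hext.2.2.1.aestronglyMeasurable
    simpa [slab] using this
  have hPm : AEStronglyMeasurable P volume :=
    aestronglyMeasurable_pressureProfile (p := selfSimilarCollapsePressure (1 / (2 + ρ)) 0 P) hpm fun _ _ => rfl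
  have hP1 : LocallyIntegrable P volume :=
    locallyIntegrable_pressureProfile_of_slab hγ.le (by linarith) hPm hext.2.2.1
  -- (3) CIV (3.3) classically for some `C¹` pressure, and rigidity
  obtain ⟨P', hprof⟩ := WeakToClassical.exists_isSelfSimilarEulerProfile_of_contDiff hext
    (fun _ _ => rfl) (fun _ _ => rfl) hV hP1
  have hconst := Loc.eq_const_of_bounded hprof hM hγ hγ2
  set b : EuclideanSpace ℝ (Fin 3) := V 0 with hb
  have hVb : V = fun _ => b := funext fun z => hconst z 0
  -- (4) the member's own `A`-gauge kills the constant
  rw [hVb] at hu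
  have hb0 : b = 0 := const_profile_eq_zero_of_gaugeA hρ hT x₀ hu hA
  -- conclusion
  have hS : MeasurableSet (Iio (0 : ℝ) ×ˢ (univ : Set (EuclideanSpace ℝ (Fin 3)))) :=
    measurableSet_Iio.prod MeasurableSet.univ
  refine (ae_restrict_mem hS).mono fun z hz => ?_
  obtain ⟨hτ, -⟩ := hz
  have hτ' : z.1 < 0 := hτ
  change u z.1 z.2 = 0
  rw [hu z.1 hτ']
  simp [selfSimilarCollapse_apply, hb0]

end Shifted

end Summit.NavierStokesRegularity.NavierStokesRegularity.Theorems.PowerGaugeEulerLiouville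

end
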